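import Summits.Ventures.HodgeRepro2.T5SU11RadialLaplacian

/-!
# Uniqueness: `φ_λ(a_t)` is the ONLY `C²` solution of the radial equation with value `1` at `t = 0`;
the Wronskian of two solutions vanishes; the Lagrange identity for two parameters

Green's identity (`T5SU11RadialLaplacian`) applied to two solutions `u, v` of the radial equation
`(sinh 2t · w')' = λ(λ − 2) sinh 2t · w` with the SAME parameter makes both integrals equal, so the
boundary term vanishes: **the Wronskian `sinh 2R (u'(R) v(R) − u(R) v'(R))` is identically zero**
(`wronskian_eq_zero`). Taking `u = φ_λ(a_·)` (`T5SU11SphericalODE`), which is strictly positive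
(`T5SU11SphericalBounds.sph_pos`), the quotient `v/φ_λ` has zero derivative — at `t = 0` because the
equation itself forces `v'(0) = 0` (its value at `0` reads `2 v'(0) = 0`) — hence is constant:
**every `C²` solution `v` of the radial equation with `v(0) = 1` is `t ↦ φ_λ(a_t)`** (`eq_sph_hyp_of_ode`;
in particular the normalised solution is unique, `ode_solution_unique`). No evenness or second initial
condition is needed: the regular-singular point `t = 0` of the equation absorbs it. For two DIFFERENT
parameters the boundary term survives as the **Lagrange identity**
`(λ(λ−2) − μ(μ−2)) ∫_0^R sinh 2t φ_λ(a_t) φ_μ(a_t) dt = sinh 2R (φ_λ'(R) φ_μ(R) − φ_λ(R) φ_μ'(R))`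
(`lagrange_identity`). Nothing is claimed about (N).

Blind lane: Mathlib + the HodgeRepro2 prefix only; no sorry; axioms ⊆ {propext, Classical.choice,
Quot.sound}.
-/

namespace Summit.Ventures.HodgeRepro2.T5SU11SphericalUnique

open MeasureTheory Metric Set Filter Topology intervalIntegral
open T5SU11Unimodular T5SU11Cartan T5SU11SphericalFunction T5SU11SphericalBounds
  T5SU11SphericalContinuous T5SU11SphericalODE T5SU11RadialLaplacian
open scoped Real

/-! ### The Wronskian of two solutions -/

/-- **The Wronskian of two solutions of the radial equation vanishes**: if `u, v` are `C²` with
`(sinh 2t u')' = c sinh 2t u` and `(sinh 2t v')' = c sinh 2t v` for the same constant `c`, then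
`sinh 2R (u'(R) v(R) − u(R) v'(R)) = 0` for every `R`. -/
theorem wronskian_eq_zero {c : ℝ} {u u' u'' v v' v'' : ℝ → ℝ}
    (hu : ∀ t, HasDerivAt u (u' t) t) (hu' : ∀ t, HasDerivAt u' (u'' t) t)
    (hode_u : ∀ t, Real.sinh (2 * t) * u'' t + 2 * Real.cosh (2 * t) * u' t = c * Real.sinh (2 * t) * u t)
    (hv : ∀ t, HasDerivAt v (v' t) t) (hv' : ∀ t, HasDerivAt v' (v'' t) t)
    (hode_v : ∀ t, Real.sinh (2 * t) * v'' t + 2 * Real.cosh (2 * t) * v' t = c * Real.sinh (2 * t) * v t)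
    (R : ℝ) :
    Real.sinh (2 * R) * (u' R * v R - u R * v' R) = 0 := by
  have hcu : Continuous u := continuous_iff_continuousAt.mpr fun t => (hu t).continuousAt
  have hcv : Continuous v := continuous_iff_continuousAt.mpr fun t => (hv t).continuousAt
  have hcs : Continuous fun t : ℝ => Real.sinh (2 * t) := by fun_prop
  have hW : IntervalIntegrable (fun t => 2 * Real.cosh (2 * t) * u' t + Real.sinh (2 * t) * u'' t)
      volume 0 R := by
    have e : (fun t => 2 * Real.cosh (2 * t) * u' t + Real.sinh (2 * t) * u'' t)
        = fun t => c * Real.sinh (2 * t) * u t := by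
      funext t; rw [← hode_u t]; ring
    rw [e]
    exact ((continuous_const.mul hcs).mul hcu).intervalIntegrable _ _
  have hW' : IntervalIntegrable (fun t => 2 * Real.cosh (2 * t) * v' t + Real.sinh (2 * t) * v'' t)
      volume 0 R := by
    have e : (fun t => 2 * Real.cosh (2 * t) * v' t + Real.sinh (2 * t) * v'' t)
        = fun t => c * Real.sinh (2 * t) * v t := by
      funext t; rw [← hode_v t]; ring
    rw [e]
    exact ((continuous_const.mul hcs).mul hcv).intervalIntegrable _ _
  have hg := green_identity hu hu' hW hv hv' hW'
  rw [← hg]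
  have e1 : ∫ t in (0 : ℝ)..R, (Real.sinh (2 * t) * u'' t + 2 * Real.cosh (2 * t) * u' t) * v t
      = ∫ t in (0 : ℝ)..R, c * Real.sinh (2 * t) * u t * v t :=
    integral_congr fun t _ => by rw [hode_u t]
  have e2 : ∫ t in (0 : ℝ)..R, u t * (Real.sinh (2 * t) * v'' t + 2 * Real.cosh (2 * t) * v' t)
      = ∫ t in (0 : ℝ)..R, c * Real.sinh (2 * t) * u t * v t :=
    integral_congr fun t _ => by rw [hode_v t]; ring
  rw [e1, e2, sub_self]

/-- The radial equation at `t = 0` forces `v'(0) = 0`. -/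
lemma deriv_zero_of_ode {c : ℝ} {v v' v'' : ℝ → ℝ}
    (hode : ∀ t, Real.sinh (2 * t) * v'' t + 2 * Real.cosh (2 * t) * v' t = c * Real.sinh (2 * t) * v t) :
    v' 0 = 0 := by
  have h := hode 0
  simp only [mul_zero, Real.sinh_zero, Real.cosh_zero, zero_mul, mul_one, zero_add] at h
  linarith

section measure

variable [MeasurableSpace Circle] [BorelSpace Circle]

/-! ### Uniqueness -/

/-- **UNIQUENESS OF THE SPHERICAL FUNCTION AS A SOLUTION OF THE RADIAL EQUATION**: a `C²` function `v` with
`(sinh 2t v')' = λ(λ − 2) sinh 2t v` on `ℝ` and `v(0) = 1` is `t ↦ φ_λ(a_t)`. -/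
theorem eq_sph_hyp_of_ode (lam : ℝ) {v v' v'' : ℝ → ℝ}
    (hv : ∀ t, HasDerivAt v (v' t) t) (hv' : ∀ t, HasDerivAt v' (v'' t) t)
    (hode : ∀ t, Real.sinh (2 * t) * v'' t + 2 * Real.cosh (2 * t) * v' t
      = lam * (lam - 2) * Real.sinh (2 * t) * v t)
    (h0 : v 0 = 1) (t : ℝ) : v t = sph lam (hyp t) := by
  obtain ⟨φ', φ'', hφ, hφ', hode_φ⟩ := exists_hasDerivAt_sph_hyp_ode lam
  -- the Wronskian vanishes identically
  have hW : ∀ R, φ' R * v R - sph lam (hyp R) * v' R = 0 := by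
    intro R
    rcases eq_or_ne R 0 with hR | hR
    · subst hR
      rw [deriv_zero_of_ode hode, deriv_zero_of_ode hode_φ, mul_zero, zero_mul, sub_zero]
    · have h := wronskian_eq_zero hφ hφ' hode_φ hv hv' hode R
      have hs : Real.sinh (2 * R) ≠ 0 := by
        intro h2
        exact hR (by have := Real.sinh_eq_zero.mp h2; linarith)
      exact (mul_eq_zero.mp h).resolve_left hs
  -- the quotient `v / φ_λ` has zero derivative
  have hpos : ∀ s, 0 < sph lam (hyp s) := fun s => sph_hyp_pos lam s
  have hdiff : ∀ s, HasDerivAt (fun s => v s / sph lam (hyp s)) 0 s := by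
    intro s
    have h := (hv s).div (hφ s) (hpos s).ne'
    refine h.congr_deriv ?_
    have := hW s
    rw [show v' s * sph lam (hyp s) - v s * φ' s = -(φ' s * v s - sph lam (hyp s) * v' s) by ring, this]
    simp
  have hconst := is_const_of_deriv_eq_zero (fun s => (hdiff s).differentiableAt) fun s => (hdiff s).deriv
  have h := hconst t 0
  have h1 : sph lam (hyp 0) = 1 := by rw [T5SU11OneParameter.hyp_zero, sph_one]
  rw [h0, h1, div_one, div_eq_iff (hpos t).ne', one_mul] at h
  exact h

/-- **Two `C²` solutions of the radial equation with the same value at `0` coincide.** -/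
theorem ode_solution_unique (lam : ℝ) {u u' u'' v v' v'' : ℝ → ℝ}
    (hu : ∀ t, HasDerivAt u (u' t) t) (hu' : ∀ t, HasDerivAt u' (u'' t) t)
    (hode_u : ∀ t, Real.sinh (2 * t) * u'' t + 2 * Real.cosh (2 * t) * u' t
      = lam * (lam - 2) * Real.sinh (2 * t) * u t)
    (hv : ∀ t, HasDerivAt v (v' t) t) (hv' : ∀ t, HasDerivAt v' (v'' t) t)
    (hode_v : ∀ t, Real.sinh (2 * t) * v'' t + 2 * Real.cosh (2 * t) * v' t
      = lam * (lam - 2) * Real.sinh (2 * t) * v t)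
    (h0 : u 0 = v 0) (hu0 : u 0 = 1) : u = v := by
  funext t
  rw [eq_sph_hyp_of_ode lam hu hu' hode_u hu0 t, eq_sph_hyp_of_ode lam hv hv' hode_v (h0 ▸ hu0) t]

/-! ### The Lagrange identity -/

/-- **The Lagrange identity for two parameters**: with `φ_λ' = ∂_t φ_λ(a_t)`,
`(λ(λ−2) − μ(μ−2)) ∫_0^R sinh 2t φ_λ(a_t) φ_μ(a_t) dt = sinh 2R (φ_λ'(R) φ_μ(R) − φ_λ(R) φ_μ'(R))`. -/
theorem lagrange_identity (lam mu R : ℝ) :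
    (lam * (lam - 2) - mu * (mu - 2)) * ∫ t in (0 : ℝ)..R,
        Real.sinh (2 * t) * sph lam (hyp t) * sph mu (hyp t)
      = Real.sinh (2 * R) * (deriv (fun t => sph lam (hyp t)) R * sph mu (hyp R)
          - sph lam (hyp R) * deriv (fun t => sph mu (hyp t)) R) := by
  obtain ⟨φ', φ'', hφ, hφ', hode_φ⟩ := exists_hasDerivAt_sph_hyp_ode lam
  obtain ⟨ψ', ψ'', hψ, hψ', hode_ψ⟩ := exists_hasDerivAt_sph_hyp_ode mu
  have hcs : Continuous fun t : ℝ => Real.sinh (2 * t) := by fun_prop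
  have hW : IntervalIntegrable (fun t => 2 * Real.cosh (2 * t) * φ' t + Real.sinh (2 * t) * φ'' t)
      volume 0 R := by
    have e : (fun t => 2 * Real.cosh (2 * t) * φ' t + Real.sinh (2 * t) * φ'' t)
        = fun t => lam * (lam - 2) * Real.sinh (2 * t) * sph lam (hyp t) := by
      funext t; rw [← hode_φ t]; ring
    rw [e]
    exact ((continuous_const.mul hcs).mul (continuous_sph_hyp lam)).intervalIntegrable _ _
  have hW' : IntervalIntegrable (fun t => 2 * Real.cosh (2 * t) * ψ' t + Real.sinh (2 * t) * ψ'' t)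
      volume 0 R := by
    have e : (fun t => 2 * Real.cosh (2 * t) * ψ' t + Real.sinh (2 * t) * ψ'' t)
        = fun t => mu * (mu - 2) * Real.sinh (2 * t) * sph mu (hyp t) := by
      funext t; rw [← hode_ψ t]; ring
    rw [e]
    exact ((continuous_const.mul hcs).mul (continuous_sph_hyp mu)).intervalIntegrable _ _
  have hg := green_identity hφ hφ' hW hψ hψ' hW'
  have e1 : ∫ t in (0 : ℝ)..R, (Real.sinh (2 * t) * φ'' t + 2 * Real.cosh (2 * t) * φ' t)
      * sph mu (hyp t)
      = lam * (lam - 2) * ∫ t in (0 : ℝ)..R, Real.sinh (2 * t) * sph lam (hyp t) * sph mu (hyp t) := by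
    rw [← intervalIntegral.integral_const_mul]
    exact integral_congr fun t _ => by rw [hode_φ t]; ring
  have e2 : ∫ t in (0 : ℝ)..R, sph lam (hyp t)
      * (Real.sinh (2 * t) * ψ'' t + 2 * Real.cosh (2 * t) * ψ' t)
      = mu * (mu - 2) * ∫ t in (0 : ℝ)..R, Real.sinh (2 * t) * sph lam (hyp t) * sph mu (hyp t) := by
    rw [← intervalIntegral.integral_const_mul]
    exact integral_congr fun t _ => by rw [hode_ψ t]; ring
  rw [e1, e2] at hg
  rw [(hφ R).deriv, (hψ R).deriv, ← hg]
  ring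

end measure

end Summit.Ventures.HodgeRepro2.T5SU11SphericalUnique
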